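import Summits.SmoothPoincare4.SmoothPoincare4.Theorems.SullivanDualWitnessChargeHelperRescaleAway
import Summits.SmoothPoincare4.SmoothPoincare4.Theorems.SullivanDualWitnessChargeHelperRescaleLocal

/-!
# (P5)(B) The rescaling branch on `Σ ∖ p` — unconditional-in-the-line form (modulo the named fact
`JHolomorphicWeierstrassR4`)

Crux `WitnessCharge` (stmt-SmoothPoincare4-7824, route `SullivanDual`), line `Sketch`, registered
helper `helper_rescaleAway` (lead, cycle 2): `helper_rescaleAway_of` (p122123) with its local-lemma
hypothesis discharged by `helper_rescaleLocal` (p122165). This is branch (B) of the frontier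
dichotomy (P5) of the card `Cruxes/WitnessCharge/Lines/Sketch.md`: gradient blow-up of pencil
members forces a bounded entire `J`-curve; the only non-elementary input is the generalized
Weierstraß theorem for `J`-holomorphic maps (`Literature.Geometry.Symplectic.JHolomorphicWeierstrassR4`,
an unproved named fact = input L3 of the line).
-/

noncomputable section

set_option linter.dupNamespace false

open scoped Manifold ContDiff Topology
open Set Filter Literature.Geometry.Kaehler Literature.Geometry.Symplectic
  Literature.Topology.FourManifolds

namespace Summit.SmoothPoincare4.SmoothPoincare4.Theorems.WitnessCharge.PencilIncompleteness

/-- **(P5)(B) — the RESCALING BRANCH on `Σ ∖ p`, modulo the named fact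
`JHolomorphicWeierstrassR4` (Hummel 1997, III.3.1).** For `J` smooth with `J² = -1` on `Σ ∖ p`,
a smooth injective `ι : Σ → ℝᴺ` (e.g. a Whitney embedding, `Σ` compact), entire `J`-curves
`u n : ℂ → Σ ∖ p` mapping the disc `‖z‖ ≤ 2` into a fixed compact `K`, whose gradients (through
`ι`) are unbounded on the unit disc: some entire `J`-curve stays away from `p` (`CurveAway`) —
Zalcman–Brody rescaling (`helper_flatZalcman`), Arzelà–Ascoli (`helper_subseqLocUnif`), lift of
the limit to `K`, local regularity/holomorphy/non-degeneracy of the limit (`helper_rescaleLocal`,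
which is where the named fact enters, chart by chart), assembled in `helper_rescaleAway_of`.
(Kruglikov–Overholt 1999, Thm 2.2, for the statement in almost complex manifolds.) -/
theorem helper_rescaleAway :
    JHolomorphicWeierstrassR4 →
    ∀ (S : HomotopySphere 4) (p : S.carrier)
      (J : ∀ x : punctured p, TangentSpace (𝓡 4) x →L[ℝ] TangentSpace (𝓡 4) x),
      (∀ (x : punctured p) (v : TangentSpace (𝓡 4) x), J x (J x v) = -v) →
      (∀ x₀ : punctured p, ContMDiffAt (𝓡 4) 𝓘(ℝ, EuclideanSpace ℝ (Fin 4) →L[ℝ] EuclideanSpace ℝ (Fin 4)) ∞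
        (inTangentCoordinates (𝓡 4) (𝓡 4) (id : punctured p → punctured p) id (fun x => J x) x₀) x₀) →
      ∀ (N : ℕ) (ι : S.carrier → EuclideanSpace ℝ (Fin N)),
        ContMDiff (𝓡 4) 𝓘(ℝ, EuclideanSpace ℝ (Fin N)) ∞ ι → Function.Injective ι →
        (∀ x : S.carrier, Function.Injective (mfderiv (𝓡 4) 𝓘(ℝ, EuclideanSpace ℝ (Fin N)) ι x)) →
      ∀ (u : ℕ → ℂ → punctured p) (K : Set (punctured p)), IsCompact K →
        (∀ n, IsEntireJCurve (𝓡 4) J (u n)) →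
        (∀ n (z : ℂ), ‖z‖ ≤ 2 → u n z ∈ K) →
        (∀ C : ℝ, ∃ n, ∃ z : ℂ, ‖z‖ ≤ 1 ∧ C < ‖fderiv ℝ (fun w : ℂ => ι (u n w).1) z‖) →
        CurveAway S p J :=
  helper_rescaleAway_of helper_rescaleLocal

end Summit.SmoothPoincare4.SmoothPoincare4.Theorems.WitnessCharge.PencilIncompleteness
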